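import Summits.CriticalPhenomena.PercolationContinuityZ3.Theorems.PercNearOneGluingNoHeavyLowerTailSunflowerMultiPetalIsolated
import HarnessLib
import HarnessLib.Audit

/-!
# `NoHeavyLowerTail` (crux stmt-CriticalPhenomena-4575), abstract sunflower cubic, `k` petals: ★ₖ at a PETAL-COMPLETING coordinate —
# the multi-petal generalisation of prim-ineq-gen-2's one-point certificate, with a POINTWISE (un-symmetrised) kernel inequality

Support file (seat `prim-l12-p2` gen 26; `--supports stmt-CriticalPhenomena-4575`; companion of `…SunflowerMultiPetal` (p338110), `…SunflowerMultiPetalSpectator`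
(p339016: charts `chart3`, `kkK`, `s6K_congr`, `kkK_congr`, `MSunflower.antipodal_gladkov`), `…SunflowerMultiPetalIsolated` (p339929), `…SunflowerRestrictionSeriesPair`
(`nested_insert_split`), and — for `k = 3` — prim-ineq-gen-2's `…SunflowerOnePointCertificates` (`Sunflower.ZH_nonneg_of_petalCompleting`)).  No `sorry`; nothing about the crux.
Memo: run/shared/lean/prim/prim-l12/prim-l12-p2/FINDING-g26-MULTIPETAL-COMPONENT-LEMMA.md §4.8.

THEOREM (`MSunflower.ZK_nonneg_of_petalCompleting`, this work).  Let `F : MSunflower k α` (any number `k` of petals) and let the coordinate `e` be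
PETAL-COMPLETING: `insert e X ∈ A` for every petal set `X` with `e ∉ X`.  Then `0 ≤ F.ZK`, i.e. ★ₖ holds for `F`.  Quantitatively
`ZK ≥ kk-sums of the lower section ≥ 0`.  PROOF: expand `ZK` along `e` (`nested_insert_split`); for every ordered 3-partition `(X,Y,Z)` of `univ ∖ {e}` the
one-point codes satisfy `lab X = 0 ∨ lab (insert e X) = ⊤` (kernel and petal sets are completed to the kernel), and under these three constraints alone
  `kkK (lab Y) (lab Z) + kkK (lab X) (lab Z) + kkK (lab X) (lab Y) ≤ s6K (lab (X+e)) (lab Y) (lab Z) + s6K (lab X) (lab (Y+e)) (lab Z) + s6K (lab X) (lab Y) (lab (Z+e))`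
POINTWISE (`pcIneqK`; for `k = 3` a `decide` over `5⁶` codes, `pcIneq5`, transported to every `k` by charting the at most three petal values among the six labels
into `Fin 5`, `chart3_eq_iff_petal`); the three `kkK` nested sums are antipodal-Gladkov sums of the complement cubes, hence `≥ 0`.  No symmetrisation over block orders is
needed (prim-ineq-gen-2's `M₃` certificate symmetrises).  COROLLARY: ★ₖ for every `MSunflower` with isolated petal sets (every coordinate is petal-completing) — a second
proof of `MSunflower.ZK_nonneg_of_isolated` (p339929), without its Lemma-B refinement.
-/

namespace Summit.CriticalPhenomena.PercolationContinuityZ3.Theorems.SunflowerPartition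

open Finset

variable {α : Type*} [DecidableEq α]

/-! ## The pointwise one-point inequality -/

/-- The chart `chart3 k x y` is injective on labels among which at most one petal differs from `x` and `y` (petal-premise version of `chart3_eq_iff`). [this work] -/
theorem chart3_eq_iff_petal (k : ℕ) (x y : Fin (k + 2)) {w w' : Fin (k + 2)}
    (hz : w ≠ Fin.last (k + 1) → w ≠ 0 → w ≠ x → w ≠ y → w' ≠ Fin.last (k + 1) → w' ≠ 0 → w' ≠ x → w' ≠ y → w = w') :
    w = w' ↔ chart3 k x y w = chart3 k x y w' := by
  constructor
  · rintro rfl; rfl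
  · intro h
    unfold chart3 at h
    split_ifs at h <;> first | (subst_vars; rfl) | simp_all

/-- The one-point inequality on `Fin 5` codes (`decide`): lower labels `x0,y0,z0`, upper labels `x1,y1,z1` with `x0 = 0 ∨ x1 = ⊤` etc. [this work] -/
theorem pcIneq5 : ∀ x0 x1 y0 y1 z0 z1 : Fin 5, (x0 = 0 ∨ x1 = 4) → (y0 = 0 ∨ y1 = 4) → (z0 = 0 ∨ z1 = 4) →
    kkK 3 y0 z0 + kkK 3 x0 z0 + kkK 3 x0 y0 ≤ s6K 3 x1 y0 z0 + s6K 3 x0 y1 z0 + s6K 3 x0 y0 z1 := by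
  decide

/-- **The one-point inequality for every `k`** (chart the at most three petal values among the six labels into `Fin 5`). [this work] -/
theorem pcIneqK {k : ℕ} (x0 x1 y0 y1 z0 z1 : Fin (k + 2)) (hx : x0 = 0 ∨ x1 = Fin.last (k + 1)) (hy : y0 = 0 ∨ y1 = Fin.last (k + 1))
    (hz : z0 = 0 ∨ z1 = Fin.last (k + 1)) :
    kkK k y0 z0 + kkK k x0 z0 + kkK k x0 y0 ≤ s6K k x1 y0 z0 + s6K k x0 y1 z0 + s6K k x0 y0 z1 := by
  -- anchors: the petal value of position 1 and of position 2 (if any)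
  set P1 : Fin (k + 2) := if x0 = 0 then x1 else x0 with hP1
  set P2 : Fin (k + 2) := if y0 = 0 then y1 else y0 with hP2
  set c := chart3 k P1 P2 with hc
  have e4 : (4 : Fin 5) = Fin.last (3 + 1) := rfl
  have T := fun w => e4 ▸ (chart3_eq_four_iff k P1 P2 w).symm
  have Zr := fun w => (chart3_eq_zero_iff k P1 P2 w).symm
  -- which labels can be "other" petals: only z0 or z1
  have nx0 : x0 ≠ Fin.last (k + 1) → x0 ≠ 0 → x0 ≠ P1 → False := by
    intro _ h0 hp; apply hp; rw [hP1, if_neg h0]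
  have nx1 : x1 ≠ Fin.last (k + 1) → x1 ≠ 0 → x1 ≠ P1 → False := by
    intro ht _ hp; apply hp; rcases hx with h0 | h1
    · rw [hP1, if_pos h0]
    · exact absurd h1 ht
  have ny0 : y0 ≠ Fin.last (k + 1) → y0 ≠ 0 → y0 ≠ P2 → False := by
    intro _ h0 hp; apply hp; rw [hP2, if_neg h0]
  have ny1 : y1 ≠ Fin.last (k + 1) → y1 ≠ 0 → y1 ≠ P2 → False := by
    intro ht _ hp; apply hp; rcases hy with h0 | h1
    · rw [hP2, if_pos h0]
    · exact absurd h1 ht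
  -- pair equalities through the chart (first member of each pair is never an "other" petal, or the second is not)
  have Exy : ∀ {w w' : Fin (k + 2)}, (w ≠ Fin.last (k + 1) → w ≠ 0 → w ≠ P1 → w ≠ P2 → False) → (w = w' ↔ c w = c w') :=
    fun hw => chart3_eq_iff_petal k P1 P2 (fun a b d g _ _ _ _ => (hw a b d g).elim)
  have Exy' : ∀ {w w' : Fin (k + 2)}, (w' ≠ Fin.last (k + 1) → w' ≠ 0 → w' ≠ P1 → w' ≠ P2 → False) → (w = w' ↔ c w = c w') :=
    fun hw => chart3_eq_iff_petal k P1 P2 (fun _ _ _ _ a b d g => (hw a b d g).elim)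
  have hX0 : x0 ≠ Fin.last (k + 1) → x0 ≠ 0 → x0 ≠ P1 → x0 ≠ P2 → False := fun a b d _ => nx0 a b d
  have hX1 : x1 ≠ Fin.last (k + 1) → x1 ≠ 0 → x1 ≠ P1 → x1 ≠ P2 → False := fun a b d _ => nx1 a b d
  have hY0 : y0 ≠ Fin.last (k + 1) → y0 ≠ 0 → y0 ≠ P1 → y0 ≠ P2 → False := fun a b _ g => ny0 a b g
  have hY1 : y1 ≠ Fin.last (k + 1) → y1 ≠ 0 → y1 ≠ P1 → y1 ≠ P2 → False := fun a b _ g => ny1 a b g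
  rw [kkK_congr (T y0) (Zr y0) (T z0) (Zr z0) (Exy hY0), kkK_congr (T x0) (Zr x0) (T z0) (Zr z0) (Exy hX0),
    kkK_congr (T x0) (Zr x0) (T y0) (Zr y0) (Exy hX0),
    s6K_congr (T x1) (Zr x1) (T y0) (Zr y0) (T z0) (Zr z0) (Exy hX1) (Exy hY0) (Exy hX1),
    s6K_congr (T x0) (Zr x0) (T y1) (Zr y1) (T z0) (Zr z0) (Exy hX0) (Exy hY1) (Exy hX0),
    s6K_congr (T x0) (Zr x0) (T y0) (Zr y0) (T z1) (Zr z1) (Exy hX0) (Exy hY0) (Exy hX0)]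
  refine pcIneq5 _ _ _ _ _ _ ?_ ?_ ?_
  · rcases hx with h | h
    · exact Or.inl ((Zr x0).1 h)
    · exact Or.inr (e4 ▸ (T x1).1 h)
  · rcases hy with h | h
    · exact Or.inl ((Zr y0).1 h)
    · exact Or.inr (e4 ▸ (T y1).1 h)
  · rcases hz with h | h
    · exact Or.inl ((Zr z0).1 h)
    · exact Or.inr (e4 ▸ (T z1).1 h)

/-! ## ★ₖ at a petal-completing coordinate -/

namespace MSunflower

variable [Fintype α] {k : ℕ} (F : MSunflower k α)

omit [Fintype α] in
/-- At a petal-completing coordinate every block code satisfies `lab X = 0 ∨ lab (insert e X) = ⊤`. [this work] -/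
theorem lab_zero_or_insert_top {e : α} (hpc : ∀ X : Finset α, e ∉ X → X ∉ F.A → (∃ i, X ∈ F.V i) → insert e X ∈ F.A)
    {X : Finset α} (heX : e ∉ X) : F.lab X = 0 ∨ F.lab (insert e X) = Fin.last (k + 1) := by
  rcases F.lab_cases X with hA | h0 | ⟨i, hA, hi, _⟩
  · exact Or.inr ((F.lab_eq_last_iff _).2 (F.upperA (subset_insert e X) hA))
  · exact Or.inl h0
  · exact Or.inr ((F.lab_eq_last_iff _).2 (hpc X heX hA ⟨i, hi⟩))

omit [Fintype α] in
/-- A nested `kkK`-sum with a free first block is a sum of antipodal-Gladkov sums, hence nonnegative. [this work] -/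
theorem nested_kkK_nonneg (W : Finset α) : 0 ≤ nested W (fun _ Y Z => kkK k (F.lab Y) (F.lab Z)) := by
  unfold nested
  exact sum_nonneg fun X _ => F.antipodal_gladkov (W \ X)

/-- **★ₖ AT A PETAL-COMPLETING COORDINATE** (this work): if some coordinate `e` completes every petal set avoiding it into the kernel, then `0 ≤ F.ZK` —
for every number `k` of petals. [this work] -/
theorem ZK_nonneg_of_petalCompleting (e : α)
    (hpc : ∀ X : Finset α, e ∉ X → X ∉ F.A → (∃ i, X ∈ F.V i) → insert e X ∈ F.A) : 0 ≤ F.ZK := by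
  have hW : (univ : Finset α) = insert e (univ.erase e) := by rw [insert_erase (mem_univ e)]
  have he : e ∉ (univ : Finset α).erase e := notMem_erase e univ
  unfold ZK
  rw [sum_parts_eq_nested_univ (g := fun X Y Z => s6K k (F.lab X) (F.lab Y) (F.lab Z)), hW,
    nested_insert_split _ e he]
  set W := (univ : Finset α).erase e with hWdef
  -- the three kk-sums of the lower section are nonnegative
  have h1 : 0 ≤ nested W (fun _ Y Z => kkK k (F.lab Y) (F.lab Z)) := F.nested_kkK_nonneg W
  have h2 : 0 ≤ nested W (fun X _ Z => kkK k (F.lab X) (F.lab Z)) := by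
    rw [nested_swap12]; exact F.nested_kkK_nonneg W
  have h3 : 0 ≤ nested W (fun X Y _ => kkK k (F.lab X) (F.lab Y)) := by
    rw [nested_swap23, nested_swap12]; exact F.nested_kkK_nonneg W
  -- pointwise comparison
  have key : nested W (fun _ Y Z => kkK k (F.lab Y) (F.lab Z)) + nested W (fun X _ Z => kkK k (F.lab X) (F.lab Z))
      + nested W (fun X Y _ => kkK k (F.lab X) (F.lab Y))
      ≤ nested W (fun X S T => s6K k (F.lab (insert e X)) (F.lab S) (F.lab T))
        + nested W (fun X S T => s6K k (F.lab X) (F.lab (insert e S)) (F.lab T))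
        + nested W (fun X S T => s6K k (F.lab X) (F.lab S) (F.lab (insert e T))) := by
    unfold nested
    rw [← sum_add_distrib, ← sum_add_distrib, ← sum_add_distrib, ← sum_add_distrib]
    refine sum_le_sum fun X hX => ?_
    rw [← sum_add_distrib, ← sum_add_distrib, ← sum_add_distrib, ← sum_add_distrib]
    refine sum_le_sum fun Y hY => ?_
    have heX : e ∉ X := fun h => he (mem_powerset.1 hX h)
    have hYW : Y ⊆ W \ X := mem_powerset.1 hY
    have heY : e ∉ Y := fun h => he ((mem_sdiff.1 (hYW h)).1)
    have heT : e ∉ (W \ X) \ Y := fun h => he ((mem_sdiff.1 (mem_sdiff.1 h).1).1)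
    exact pcIneqK _ _ _ _ _ _ (F.lab_zero_or_insert_top hpc heX) (F.lab_zero_or_insert_top hpc heY)
      (F.lab_zero_or_insert_top hpc heT)
  linarith

/-- **Second proof of ★ₖ for isolated petals**: if every petal set is isolated from below then every coordinate is petal-completing. [this work] -/
theorem ZK_nonneg_of_isolated' [Nonempty α]
    (hiso : ∀ i (T : Finset α), T ∈ F.V i → T ∉ F.A → ∀ x ∈ T, ∀ j, T.erase x ∉ F.V j) : 0 ≤ F.ZK := by
  obtain ⟨e⟩ := (inferInstance : Nonempty α)
  refine F.ZK_nonneg_of_petalCompleting e fun X heX hXA ⟨i, hi⟩ => ?_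
  -- `insert e X ⊋ X` lies in `V i`; if it were not in the kernel it would be a petal set whose lower cover `X` lies in `V i` — impossible
  by_contra hA
  have hins : insert e X ∈ F.V i := F.upperV i (subset_insert e X) hi
  have := hiso i (insert e X) hins hA e (mem_insert_self e X) i
  rw [erase_insert heX] at this
  exact this hi

end MSunflower

end Summit.CriticalPhenomena.PercolationContinuityZ3.Theorems.SunflowerPartition
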